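import Mathlib
import HarnessLib
import Summits.QuantumFields.YangMills.Theorems.PencilRigidityCurvatureKernelBoundSwapOffDiagonalInfiniteVolumeCS
import Summits.QuantumFields.YangMills.Theorems.PencilRigidityCurvatureKernelBoundTorusInfiniteVolumeComparison
import Summits.QuantumFields.YangMills.Theorems.PencilRigidityCurvatureKernelBoundTwoPointLocalBoundSemiDegenerate
import Summits.QuantumFields.YangMills.Theorems.PencilRigidityCurvatureKernelBoundFiniteCouplingStrongTempered
import Summits.QuantumFields.YangMills.Theorems.PencilRigidityCurvatureKernelBoundSwapOffDiagonalVanishing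
import Literature.MathematicalPhysics.QuantumFieldTheory.YangMillsOS

/-!
# `CurvatureKernelBound` — brick `SwapOffDiagonalVanishingR` of lead c11's "radius `betaOne`" wave
# (crux stmt-QuantumFields-11687, line `coupling-trichotomy`, skeleton v11, brick R5)

This is lead c10's brick `SwapOffDiagonalVanishing` with its hypotheses re-threaded:

* the (idle) radius hypothesis is relaxed from `β' < β₁/4` to `β' < β₁ = betaOne 4 r.ρ`;
* the renormalisation rate `c_k² e^{−μ'(L_k − T/a_k)} → 0` is required only at the finite-size
  rate `μ'` (for every `T`), not at every `κ > 0`;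
* the torus ↔ infinite-volume comparison (the conclusion of `TorusInfiniteVolumeComparison`, with
  its constant `K`, at every `k` with `|β_k| ≤ β'`) is a HYPOTHESIS `hK`, replacing the finite-size
  input `(Afs, hFS)` from which c10's brick derived it.

Along a scaling scheme `sch` (spacing `a_k → 0`, box half-side `L_k` with `a_k L_k → ∞`, couplings
`0 ≤ β_k ≤ β'` eventually), write `T^T_k(f, h) = LS₂(![f, h]) − LS₁(f) LS₁(h)` for the truncated
renormalised lattice two-point function of the curvature on the torus, and
`T^∞_k(f, h) = c_k² a_k⁸ Σ_{x,y} f(a_k x) h(a_k y) (P_{β_k}(y − x) − q_{β_k}²)` for its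
infinite-volume model built from the box limits `q, P` of the free-boundary strong-coupling states
(hypothesis `hF5`).  HYPOTHESIS `hA` (sibling `SwapDiagonalVanishingR`): `T^T_k(g ∘ swap, g) → 0` for
every `g` supported in a half space `{δ ≤ z 0 − z 1} ∩ B̄(0, T)`.  CLAIM: `T^T_k(f₀, f₁) → 0` whenever
`f₀` is supported in `{z 0 − z 1 ≤ −δ} ∩ B̄(0, T)` and `f₁` in `{δ ≤ z 0 − z 1} ∩ B̄(0, T)`.

Proof (lead c10's, unchanged).  (1) The mirror images `f₀θ = f₀ ∘ swap`, `f₁θ = f₁ ∘ swap` are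
Schwartz (`SwapOffDiag.exists_schwartz_swap`); `hA` gives `T^T_k(f₁θ, f₁) → 0` and
`T^T_k(f₀, f₀θ) → 0`.  (2) The comparison `hK` and the rate at `μ'` give
`T^T_k(f, h) − T^∞_k(f, h) → 0` for every pair supported in `B̄(0, T)` (lattice point count
`a⁴ Σ |f(a x)| ≤ (3T)⁴ sup|f|`; lemma `SwapOffDiag.tendsto_torus_sub_infiniteVolume_R`), so
`T^∞_k(f₁θ, f₁) → 0`, `T^∞_k(f₀, f₀θ) → 0`.  (3) Reflection positivity of the infinite-volume state
across the diagonal mirror (`SwapOffDiagonalInfiniteVolumeCS`) gives, for large `k`,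
`T^∞_k(f₀, f₁)² ≤ T^∞_k(f₁θ, f₁) T^∞_k(f₀, f₀θ)`, hence `T^∞_k(f₀, f₁) → 0` and finally
`T^T_k(f₀, f₁) → 0` by (2).
-/

noncomputable section

open scoped BigOperators Topology SchwartzMap
open MeasureTheory Filter Set
open Literature.MathematicalPhysics.QuantumLattice Literature.MathematicalPhysics.QuantumFieldTheory
  Literature.Probability.LatticeModels

namespace Summit.QuantumFields.YangMills.Theorems.CurvatureKernel

namespace SwapOffDiag

/-! ## Torus versus infinite volume along the scheme (comparison as a hypothesis) -/

section TransferR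

variable {G : Type} [Group G] [TopologicalSpace G] [IsTopologicalGroup G] [CompactSpace G]
  [MeasurableSpace G] [BorelSpace G]

/-- **Transfer (re-threaded).** Along the scheme, for test functions supported in `B̄(0, T)`, the
truncated renormalised lattice two-point function on the torus and its infinite-volume model
`c_k² a_k⁸ ΣΣ f(a x) h(a y) (P(y − x) − q²)` have the same asymptotics: their difference tends to
`0`.  Inputs: the torus ↔ infinite-volume comparison `hK` (conclusion of
`TorusInfiniteVolumeComparison`, at every `k` with `|β_k| ≤ β'`), the renormalisation rate at the
finite-size rate `μ'`, and the lattice point count. [folklore] -/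
theorem tendsto_torus_sub_infiniteVolume_R (r : LatticeRep G) (sch : SpeciesScheme (YMSpecies G))
    (β' : ℝ) (h0 : ∀ k, 0 ≤ sch.β k) (hβ : ∀ᶠ k in atTop, sch.β k ≤ β')
    (q : ℝ → ℝ) (P : ℝ → Site 4 → ℝ)
    (hF5 : ∀ β : ℝ, 0 ≤ β → β ≤ β' →
      (∀ x : Site 4, HasBoxLimit (fun Λ => zdExpect r.ρ β Λ
        (r.curvature.F ∘ ZdGaugeConfig.translate x)) (q β)) ∧
      (∀ x y : Site 4, HasBoxLimit (fun Λ => zdExpect r.ρ β Λ (fun U =>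
        r.curvature.F (ZdGaugeConfig.translate x U) * r.curvature.F (ZdGaugeConfig.translate y U)))
        (P β (y - x))))
    (μ' K : ℝ) (hμ' : 0 < μ')
    (hrate : ∀ T : ℝ, Tendsto (fun k : ℕ => sch.c r.curvature k ^ 2 *
      Real.exp (-(μ' * ((sch.L k : ℝ) - T / sch.a k)))) atTop (𝓝 0))
    (hK : ∀ (k : ℕ) (q₀ : ℝ) (P₀ : Site 4 → ℝ), |sch.β k| ≤ β' →
      (∀ x : Site 4, HasBoxLimit (fun Λ => zdExpect r.ρ (sch.β k) Λ
        (r.curvature.F ∘ ZdGaugeConfig.translate x)) q₀) →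
      (∀ x y : Site 4, HasBoxLimit (fun Λ => zdExpect r.ρ (sch.β k) Λ (fun U =>
        r.curvature.F (ZdGaugeConfig.translate x U) * r.curvature.F (ZdGaugeConfig.translate y U)))
        (P₀ (y - x))) →
      ∀ (T : ℝ) (f h : 𝓢(EuclideanSpace ℝ (Fin 4), ℝ)), 0 < T →
        tsupport (f : EuclideanSpace ℝ (Fin 4) → ℝ) ⊆ Metric.closedBall 0 T →
        tsupport (h : EuclideanSpace ℝ (Fin 4) → ℝ) ⊆ Metric.closedBall 0 T →
        T / sch.a k + 2 < sch.L k →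
        |latticeSchwinger r.ρ sch (fun s => s.F) k 2 (fun _ => r.curvature) ![f, h] -
            latticeSchwinger r.ρ sch (fun s => s.F) k 1 (fun _ => r.curvature) (fun _ => f) *
              latticeSchwinger r.ρ sch (fun s => s.F) k 1 (fun _ => r.curvature) (fun _ => h) -
            sch.c r.curvature k ^ 2 * (sch.a k ^ 8 * ∑ x ∈ box 4 (sch.L k), ∑ y ∈ box 4 (sch.L k),
              f (sch.a k • siteToE x) * h (sch.a k • siteToE y) * (P₀ (y - x) - q₀ ^ 2))| ≤
          sch.c r.curvature k ^ 2 * K * Real.exp (-(μ' * ((sch.L k : ℝ) - (T / sch.a k + 2)))) *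
            ((sch.a k ^ 4 * ∑ x ∈ box 4 (sch.L k), |f (sch.a k • siteToE x)|) *
              (sch.a k ^ 4 * ∑ y ∈ box 4 (sch.L k), |h (sch.a k • siteToE y)|)))
    (T : ℝ) (hT : 0 < T) (f h : 𝓢(EuclideanSpace ℝ (Fin 4), ℝ))
    (hf : tsupport (f : EuclideanSpace ℝ (Fin 4) → ℝ) ⊆ Metric.closedBall 0 T)
    (hh : tsupport (h : EuclideanSpace ℝ (Fin 4) → ℝ) ⊆ Metric.closedBall 0 T) :
    Tendsto (fun k : ℕ =>
      latticeSchwinger r.ρ sch (fun s => s.F) k 2 (fun _ => r.curvature) ![f, h] -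
        latticeSchwinger r.ρ sch (fun s => s.F) k 1 (fun _ => r.curvature) (fun _ => f) *
          latticeSchwinger r.ρ sch (fun s => s.F) k 1 (fun _ => r.curvature) (fun _ => h) -
        sch.c r.curvature k ^ 2 * (sch.a k ^ 8 * ∑ x ∈ box 4 (sch.L k), ∑ y ∈ box 4 (sch.L k),
          f (sch.a k • siteToE x) * h (sch.a k • siteToE y) *
            (P (sch.β k) (y - x) - q (sch.β k) ^ 2))) atTop (𝓝 0) := by
  obtain ⟨Mf, hMf⟩ := exists_abs_le_schwartz f
  obtain ⟨Mh, hMh⟩ := exists_abs_le_schwartz h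
  set E : ℝ := max K 0 * ((3 * T) ^ 4 * Mf) * ((3 * T) ^ 4 * Mh) with hE
  -- eventually: strong coupling, fine mesh, large volume
  have hev : ∀ᶠ k in atTop, sch.β k ≤ β' ∧ sch.a k < min 1 T ∧ T + 3 ≤ sch.a k * sch.L k :=
    hβ.and ((sch.tendsto_a.eventually_lt_const (lt_min one_pos hT)).and
      (sch.tendsto_L.eventually_ge_atTop (T + 3)))
  -- the bound in that regime
  have hbound : ∀ k, sch.β k ≤ β' → sch.a k < min 1 T → T + 3 ≤ sch.a k * sch.L k →
      |latticeSchwinger r.ρ sch (fun s => s.F) k 2 (fun _ => r.curvature) ![f, h] -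
        latticeSchwinger r.ρ sch (fun s => s.F) k 1 (fun _ => r.curvature) (fun _ => f) *
          latticeSchwinger r.ρ sch (fun s => s.F) k 1 (fun _ => r.curvature) (fun _ => h) -
        sch.c r.curvature k ^ 2 * (sch.a k ^ 8 * ∑ x ∈ box 4 (sch.L k), ∑ y ∈ box 4 (sch.L k),
          f (sch.a k • siteToE x) * h (sch.a k • siteToE y) *
            (P (sch.β k) (y - x) - q (sch.β k) ^ 2))| ≤
        (sch.c r.curvature k ^ 2 * Real.exp (-(μ' * ((sch.L k : ℝ) - (T + 2) / sch.a k)))) * E := by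
    intro k hβk hak hLk
    have ha := sch.a_pos k
    have ha1 : sch.a k < 1 := hak.trans_le (min_le_left _ _)
    have haT : sch.a k < T := hak.trans_le (min_le_right _ _)
    have hβabs : |sch.β k| ≤ β' := by
      rw [abs_of_nonneg (h0 k)]
      exact hβk
    have hTL : T / sch.a k + 2 < sch.L k := by
      rw [show T / sch.a k + 2 = (T + 2 * sch.a k) / sch.a k by field_simp, div_lt_iff₀ ha]
      nlinarith
    have hcmp := hK k (q (sch.β k)) (P (sch.β k)) hβabs (hF5 _ (h0 k) hβk).1 (hF5 _ (h0 k) hβk).2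
      T f h hT hf hh hTL
    have hexp : Real.exp (-(μ' * ((sch.L k : ℝ) - (T / sch.a k + 2)))) ≤
        Real.exp (-(μ' * ((sch.L k : ℝ) - (T + 2) / sch.a k))) := by
      refine Real.exp_le_exp.2 (neg_le_neg (mul_le_mul_of_nonneg_left ?_ hμ'.le))
      have h2 : (2 : ℝ) ≤ 2 / sch.a k := by
        rw [le_div_iff₀ ha]; nlinarith
      rw [add_div]
      linarith
    have hRf := SemiDegenerate.latticeSum_le_of_tsupport_subset_closedBall' hf hMf ha haT.le (sch.L k)
    have hRh := SemiDegenerate.latticeSum_le_of_tsupport_subset_closedBall' hh hMh ha haT.le (sch.L k)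
    refine hcmp.trans ?_
    calc sch.c r.curvature k ^ 2 * K * Real.exp (-(μ' * ((sch.L k : ℝ) - (T / sch.a k + 2)))) *
          ((sch.a k ^ 4 * ∑ x ∈ box 4 (sch.L k), |f (sch.a k • siteToE x)|) *
            (sch.a k ^ 4 * ∑ y ∈ box 4 (sch.L k), |h (sch.a k • siteToE y)|))
        ≤ sch.c r.curvature k ^ 2 * max K 0 * Real.exp (-(μ' * ((sch.L k : ℝ) - (T + 2) / sch.a k))) *
          (((3 * T) ^ 4 * Mf) * ((3 * T) ^ 4 * Mh)) := by
          gcongr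
          · exact le_max_left _ _
          · exact (mul_nonneg (by positivity) (by positivity)).trans hRf
      _ = (sch.c r.curvature k ^ 2 * Real.exp (-(μ' * ((sch.L k : ℝ) - (T + 2) / sch.a k)))) * E := by
          rw [hE]; ring
  -- conclude: `c_k² e^{−μ'(L_k − (T+2)/a_k)} · E → 0`
  have hlim := (hrate (T + 2)).mul_const E
  rw [zero_mul] at hlim
  refine squeeze_zero_norm' (hev.mono fun k hk => ?_) hlim
  rw [Real.norm_eq_abs]
  exact hbound k hk.1 hk.2.1 hk.2.2

end TransferR

end SwapOffDiag

open SwapOffDiag in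
/-- **Brick `SwapOffDiagonalVanishingR`** (REGISTERED signature — do not change): given that the
truncated renormalised lattice two-point function of the curvature vanishes in the limit on every
mirror pair `(g ∘ swap, g)` across the diagonal `{z 0 = z 1}` (hypothesis `hA`), it vanishes on every
pair `(f₀, f₁)` separated by that diagonal — lead c10's `SwapOffDiagonalVanishing` with the radius
relaxed to `betaOne`, the renormalisation rate needed only at the finite-size rate `μ'`, and the
torus ↔ infinite-volume comparison (constant `K`) taken as a hypothesis.  See the module docstring
for the proof (mirror images as Schwartz maps; transfer torus ↔ infinite volume; Cauchy–Schwarz for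
the reflection-positive form of the infinite-volume strong-coupling state). [folklore] -/
theorem SwapOffDiagonalVanishingR : open Literature.MathematicalPhysics.QuantumLattice Literature.MathematicalPhysics.AQFT Literature.MathematicalPhysics.QuantumFieldTheory Literature.Probability.LatticeModels in ∀ (G : Type) [Group G] [TopologicalSpace G] [IsTopologicalGroup G] [CompactSpace G] [MeasurableSpace G] [BorelSpace G] (r : LatticeRep G) (sch : SpeciesScheme (YMSpecies G)) (β' : ℝ), 0 < β' → β' < betaOne 4 r.ρ → (∀ k, 0 ≤ sch.β k) → (∀ᶠ k in Filter.atTop, sch.β k ≤ β') → ∀ (m A : ℝ) (q : ℝ → ℝ) (P : ℝ → Site 4 → ℝ), 0 < m → (∀ β : ℝ, 0 ≤ β → β ≤ β' → (∀ x : Site 4, HasBoxLimit (fun Λ => zdExpect r.ρ β Λ (r.curvature.F ∘ ZdGaugeConfig.translate x)) (q β)) ∧ (∀ x y : Site 4, HasBoxLimit (fun Λ => zdExpect r.ρ β Λ (fun U => r.curvature.F (ZdGaugeConfig.translate x U) * r.curvature.F (ZdGaugeConfig.translate y U))) (P β (y - x))) ∧ ∀ z : Site 4, |P β z - q β ^ 2|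 ≤ A * Real.exp (-(m * ‖z‖))) → ∀ (μ' K : ℝ), 0 < μ' → (∀ T : ℝ, Filter.Tendsto (fun k : ℕ => sch.c r.curvature k ^ 2 * Real.exp (-(μ' * ((sch.L k : ℝ) - T / sch.a k)))) Filter.atTop (nhds 0)) → (∀ (k : ℕ) (q₀ : ℝ) (P₀ : Site 4 → ℝ), |sch.β k| ≤ β' → (∀ x : Site 4, HasBoxLimit (fun Λ => zdExpect r.ρ (sch.β k) Λ (r.curvature.F ∘ ZdGaugeConfig.translate x)) q₀) → (∀ x y : Site 4, HasBoxLimit (fun Λ => zdExpect r.ρ (sch.β k) Λ (fun U => r.curvature.F (ZdGaugeConfig.translate x U) * r.curvature.F (ZdGaugeConfig.translate y U))) (P₀ (y - x))) → ∀ (T : ℝ) (f h : SchwartzMap (EuclideanSpace ℝ (Fin 4)) ℝ), 0 < T → tsupport (f : EuclideanSpace ℝ (Fin 4) → ℝ) ⊆ Metric.closedBall 0 T → tsupport (h : EuclideanSpace ℝ (Fin 4) → ℝ) ⊆ Metric.closedBall 0 T → T / sch.a k + 2 < sch.L k → |latticeSchwinger r.ρ sch (fun s => s.F) k 2 (fun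 _ => r.curvature) ![f, h] - latticeSchwinger r.ρ sch (fun s => s.F) k 1 (fun _ => r.curvature) (fun _ => f) * latticeSchwinger r.ρ sch (fun s => s.F) k 1 (fun _ => r.curvature) (fun _ => h) - sch.c r.curvature k ^ 2 * (sch.a k ^ 8 * ∑ x ∈ box 4 (sch.L k), ∑ y ∈ box 4 (sch.L k), f (sch.a k • siteToE x) * h (sch.a k • siteToE y) * (P₀ (y - x) - q₀ ^ 2))| ≤ sch.c r.curvature k ^ 2 * K * Real.exp (-(μ' * ((sch.L k : ℝ) - (T / sch.a k + 2)))) * ((sch.a k ^ 4 * ∑ x ∈ box 4 (sch.L k), |f (sch.a k • siteToE x)|) * (sch.a k ^ 4 * ∑ y ∈ box 4 (sch.L k), |h (sch.a k • siteToE y)|))) → (∀ (δ T : ℝ) (g gθ : SchwartzMap (EuclideanSpace ℝ (Fin 4)) ℝ), 0 < δ → 0 < T → (∀ z ∈ tsupport (g : EuclideanSpace ℝ (Fin 4) → ℝ), δ ≤ z 0 - z 1) → tsupport (g : EuclideanSpace ℝ (Fin 4) → ℝ) ⊆ Metric.closedBall 0 T → (∀ z : EuclideanSpace ℝ (Fin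 4), gθ z = g (WithLp.toLp 2 (fun i => z (Equiv.swap (0 : Fin 4) 1 i)))) → Filter.Tendsto (fun k : ℕ => latticeSchwinger r.ρ sch (fun s => s.F) k 2 (fun _ => r.curvature) ![gθ, g] - latticeSchwinger r.ρ sch (fun s => s.F) k 1 (fun _ => r.curvature) (fun _ => gθ) * latticeSchwinger r.ρ sch (fun s => s.F) k 1 (fun _ => r.curvature) (fun _ => g)) Filter.atTop (nhds 0)) → ∀ (δ T : ℝ) (f₀ f₁ : SchwartzMap (EuclideanSpace ℝ (Fin 4)) ℝ), 0 < δ → 0 < T → (∀ z ∈ tsupport (f₀ : EuclideanSpace ℝ (Fin 4) → ℝ), z 0 - z 1 ≤ -δ) → (∀ z ∈ tsupport (f₁ : EuclideanSpace ℝ (Fin 4) → ℝ), δ ≤ z 0 - z 1) → tsupport (f₀ : EuclideanSpace ℝ (Fin 4) → ℝ) ⊆ Metric.closedBall 0 T → tsupport (f₁ : EuclideanSpace ℝ (Fin 4) → ℝ) ⊆ Metric.closedBall 0 T → Filter.Tendsto (fun k : ℕ => latticeSchwinger r.ρ sch (fun s => s.F) k 2 (fun _ => r.curvature) ![f₀,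 f₁] - latticeSchwinger r.ρ sch (fun s => s.F) k 1 (fun _ => r.curvature) (fun _ => f₀) * latticeSchwinger r.ρ sch (fun s => s.F) k 1 (fun _ => r.curvature) (fun _ => f₁)) Filter.atTop (nhds 0) := by
  intro G _ _ _ _ _ _ r sch β' _ _ h0 hβ m A q P _ hF5 μ' K hμ' hrate hK hA δ T f₀ f₁ hδ hT
    hs₀ hs₁ hb₀ hb₁
  have hF5' : ∀ β : ℝ, 0 ≤ β → β ≤ β' →
      (∀ x : Site 4, HasBoxLimit (fun Λ => zdExpect r.ρ β Λ
        (r.curvature.F ∘ ZdGaugeConfig.translate x)) (q β)) ∧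
      (∀ x y : Site 4, HasBoxLimit (fun Λ => zdExpect r.ρ β Λ (fun U =>
        r.curvature.F (ZdGaugeConfig.translate x U) * r.curvature.F (ZdGaugeConfig.translate y U)))
        (P β (y - x))) := fun β h1 h2 => ⟨(hF5 β h1 h2).1, (hF5 β h1 h2).2.1⟩
  -- (1) the mirror images `f₀θ = f₀ ∘ swap`, `f₁θ = f₁ ∘ swap`
  obtain ⟨f₀θ, hf₀θ⟩ := exists_schwartz_swap f₀
  obtain ⟨f₁θ, hf₁θ⟩ := exists_schwartz_swap f₁
  have hs₀θ : ∀ z ∈ tsupport (f₀θ : EuclideanSpace ℝ (Fin 4) → ℝ), δ ≤ z 0 - z 1 :=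
    mirror_halfspace hf₀θ hs₀
  have hb₀θ : tsupport (f₀θ : EuclideanSpace ℝ (Fin 4) → ℝ) ⊆ Metric.closedBall 0 T :=
    mirror_ball hf₀θ hb₀
  have hb₁θ : tsupport (f₁θ : EuclideanSpace ℝ (Fin 4) → ℝ) ⊆ Metric.closedBall 0 T :=
    mirror_ball hf₁θ hb₁
  -- the diagonal pairs vanish on the torus (hypothesis `hA`)
  have hA₁ := hA δ T f₁ f₁θ hδ hT hs₁ hb₁ hf₁θ
  have hA₀ := hA δ T f₀θ f₀ hδ hT hs₀θ hb₀θ (mirror_symm hf₀θ)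
  -- (2) transfer torus ↔ infinite volume for the three pairs
  have hc₀₁ := tendsto_torus_sub_infiniteVolume_R r sch β' h0 hβ q P hF5' μ' K hμ' hrate hK T hT
    f₀ f₁ hb₀ hb₁
  have hc₁₁ := tendsto_torus_sub_infiniteVolume_R r sch β' h0 hβ q P hF5' μ' K hμ' hrate hK T hT
    f₁θ f₁ hb₁θ hb₁
  have hc₀₀ := tendsto_torus_sub_infiniteVolume_R r sch β' h0 hβ q P hF5' μ' K hμ' hrate hK T hT
    f₀ f₀θ hb₀ hb₀θ
  -- the infinite-volume diagonal quantities vanish in the limit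
  have hu := hA₁.sub hc₁₁
  have hv := hA₀.sub hc₀₀
  simp only [sub_sub_cancel, sub_zero] at hu hv
  -- (3) Cauchy–Schwarz in the infinite volume, eventually
  have hev : ∀ᶠ k in atTop, sch.β k ≤ β' ∧ sch.a k ≤ δ :=
    hβ.and (sch.tendsto_a.eventually_le_const hδ)
  have hCS : ∀ᶠ k in atTop,
      (sch.c r.curvature k ^ 2 * (sch.a k ^ 8 * ∑ x ∈ box 4 (sch.L k), ∑ y ∈ box 4 (sch.L k),
        f₀ (sch.a k • siteToE x) * f₁ (sch.a k • siteToE y) *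
          (P (sch.β k) (y - x) - q (sch.β k) ^ 2))) ^ 2 ≤
      |sch.c r.curvature k ^ 2 * (sch.a k ^ 8 * ∑ x ∈ box 4 (sch.L k), ∑ y ∈ box 4 (sch.L k),
        f₁θ (sch.a k • siteToE x) * f₁ (sch.a k • siteToE y) *
          (P (sch.β k) (y - x) - q (sch.β k) ^ 2))| *
      |sch.c r.curvature k ^ 2 * (sch.a k ^ 8 * ∑ x ∈ box 4 (sch.L k), ∑ y ∈ box 4 (sch.L k),
        f₀ (sch.a k • siteToE x) * f₀θ (sch.a k • siteToE y) *
          (P (sch.β k) (y - x) - q (sch.β k) ^ 2))| := by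
    refine hev.mono fun k hk => ?_
    have h := SwapOffDiagonalInfiniteVolumeCS G r (sch.L k) (sch.a k) δ (sch.β k) (sch.a_pos k) hk.2
      (h0 k) (q (sch.β k)) (P (sch.β k)) (hF5' _ (h0 k) hk.1).1 (hF5' _ (h0 k) hk.1).2 f₀ f₀θ f₁ f₁θ
      hs₀θ hs₁ (fun x => (mirror_symm hf₀θ _).trans (by rw [swapE_smul_siteToE]))
      (mirror_lattice hf₁θ (sch.a k))
    rw [← abs_mul]
    refine le_trans ?_ (le_abs_self _)
    calc _ = (sch.c r.curvature k ^ 2) ^ 2 * (sch.a k ^ 8 * ∑ x ∈ box 4 (sch.L k),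
          ∑ y ∈ box 4 (sch.L k), f₀ (sch.a k • siteToE x) * f₁ (sch.a k • siteToE y) *
            (P (sch.β k) (y - x) - q (sch.β k) ^ 2)) ^ 2 := by ring
      _ ≤ (sch.c r.curvature k ^ 2) ^ 2 * ((sch.a k ^ 8 * ∑ x ∈ box 4 (sch.L k),
          ∑ y ∈ box 4 (sch.L k), f₁θ (sch.a k • siteToE x) * f₁ (sch.a k • siteToE y) *
            (P (sch.β k) (y - x) - q (sch.β k) ^ 2)) * (sch.a k ^ 8 * ∑ x ∈ box 4 (sch.L k),
          ∑ y ∈ box 4 (sch.L k), f₀ (sch.a k • siteToE x) * f₀θ (sch.a k • siteToE y) *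
            (P (sch.β k) (y - x) - q (sch.β k) ^ 2))) :=
          mul_le_mul_of_nonneg_left h (by positivity)
      _ = _ := by ring
  -- hence the infinite-volume off-diagonal quantity vanishes in the limit
  have hmax := hu.abs.max hv.abs
  rw [abs_zero, max_self] at hmax
  have hs : Tendsto (fun k : ℕ => sch.c r.curvature k ^ 2 * (sch.a k ^ 8 *
      ∑ x ∈ box 4 (sch.L k), ∑ y ∈ box 4 (sch.L k),
        f₀ (sch.a k • siteToE x) * f₁ (sch.a k • siteToE y) *
          (P (sch.β k) (y - x) - q (sch.β k) ^ 2))) atTop (𝓝 0) := by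
    refine squeeze_zero_norm' (hCS.mono fun k hk => ?_) hmax
    rw [Real.norm_eq_abs]
    exact abs_le_max_of_sq_le hk
  -- and so does the torus quantity
  have hfin := hc₀₁.add hs
  simp only [sub_add_cancel, add_zero] at hfin
  exact hfin

end Summit.QuantumFields.YangMills.Theorems.CurvatureKernel

end
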